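import Literature.Analysis.FluidPDE.ClassicalEulerPointData
import Literature.Analysis.FluidPDE.ThermoLinearization
import Literature.Analysis.FunctionSpaces.TorusSpaceTimeExtension
import HarnessLib

/-!
# The test functions built from a classical Euler solution (Březina–Feireisl 2018, (3.4))

For a classical solution `(ρ, u, ϑ)` on `[0,T₁) × 𝕋³` and an equation of state with Gibbs'
relation, the relative-energy method tests the measure-valued continuity, momentum and entropy
identities (BF (2.20)–(2.22)) with

* `φ₁ = ½|u|² - μ(ρ,ϑ)` (`energyTestFunction`, `μ = e - ϑ s + p/ρ` the Gibbs function),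
* `φ₂ = u`, `φ₃ = ϑ > 0`.

We prove: `φ₁` is `C¹` on `[0,T₁) × 𝕋³` (`contDiffOn_stLift_energyTestFunction`), and its
derivatives are the closed-form expressions `StrongPointData.φ₁t`, `StrongPointData.gφ₁` of
`MVRelativeEnergyPointwise.lean` (`timeDerivWithin_energyTestFunction`,
`gradient_energyTestFunction`); the pointwise divergence identity
`div(p(ρ,ϑ)u) = p divU + U·∇p` with `∫ div(p(ρ,ϑ)u) = 0` (`integral_div_pressure_flux`); the
uniform bound `Bounded M` of the point data and the compact range of `(ρ,ϑ)` on `[0,T] × 𝕋³`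
(`exists_bound_pointData`, `isCompact_range_thermo`). Global `C¹` extensions of `φ₁, u, ϑ`
beyond `[0,T]` are then provided by `Torus.exists_contDiff_one_extension`.

## References

* J. Březina, E. Feireisl, J. Math. Soc. Japan 70 (2018), §3.1.1 (3.4)–(3.5).
-/

noncomputable section

open Set Filter Function MeasureTheory
open scoped Topology BigOperators InnerProductSpace

namespace Literature.Analysis.FluidPDE

namespace CompressibleEuler

open Literature.Analysis.FunctionSpaces Literature.Analysis.FunctionSpaces.Torus StrongPointData
  EulerEOS

variable {eos : EulerEOS} {T₁ : ℝ} {ρ : ℝ → UnitAddTorus (Fin 3) → ℝ}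
  {u : ℝ → UnitAddTorus (Fin 3) → EuclideanSpace ℝ (Fin 3)} {ϑ : ℝ → UnitAddTorus (Fin 3) → ℝ}

/-- The continuity-equation test function `φ₁ = ½|u|² - μ(ρ,ϑ)` of the relative-energy method.
[cite: BrezinaFeireisl2018, (3.4)] -/
def energyTestFunction (eos : EulerEOS) (ρ : ℝ → UnitAddTorus (Fin 3) → ℝ)
    (u : ℝ → UnitAddTorus (Fin 3) → EuclideanSpace ℝ (Fin 3)) (ϑ : ℝ → UnitAddTorus (Fin 3) → ℝ)
    (t : ℝ) (x : UnitAddTorus (Fin 3)) : ℝ :=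
  ‖u t x‖ ^ 2 / 2 - eos.chemPotential (ρ t x) (ϑ t x)

/-- The Gibbs function `(ρ,Θ) ↦ μ(ρ,Θ)` is `C¹` on the open quadrant. [folklore] -/
theorem IsGibbs.contDiffOn_uncurry_chemPotential (hG : eos.IsGibbs) :
    ContDiffOn ℝ 1 (uncurry eos.chemPotential) (Ioi 0 ×ˢ Ioi 0) := by
  have : uncurry eos.chemPotential =
      fun z : ℝ × ℝ => eos.e z.1 z.2 - z.2 * eos.s z.1 z.2 + eos.p z.1 z.2 / z.1 := by
    funext z; rfl
  rw [this]
  exact (hG.2.1.sub (contDiffOn_snd.mul hG.2.2.1)).add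
    (hG.1.div contDiffOn_fst fun z hz => ne_of_gt hz.1)

namespace IsClassicalEulerSolution

/-- `φ₁` is `C¹` on `[0,T₁) × 𝕋³` (jointly, through the space–time lift). [folklore] -/
theorem contDiffOn_stLift_energyTestFunction (h : IsClassicalEulerSolution eos T₁ ρ u ϑ)
    (hG : eos.IsGibbs) :
    ContDiffOn ℝ 1 (stLift (energyTestFunction eos ρ u ϑ)) (Ico 0 T₁ ×ˢ univ) := by
  have hu : ContDiffOn ℝ 1 (stLift u) (Ico 0 T₁ ×ˢ univ) := h.smooth_velocity.of_le (by simp)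
  have hρ : ContDiffOn ℝ 1 (stLift ρ) (Ico 0 T₁ ×ˢ univ) := h.smooth_density.of_le (by simp)
  have hϑ : ContDiffOn ℝ 1 (stLift ϑ) (Ico 0 T₁ ×ˢ univ) := h.smooth_temperature.of_le (by simp)
  have hμ := (IsGibbs.contDiffOn_uncurry_chemPotential hG).comp (hρ.prodMk hϑ) fun z hz =>
    ⟨h.density_pos z.1 (mem_prod.1 hz).1 _, h.temperature_pos z.1 (mem_prod.1 hz).1 _⟩
  have heq : stLift (energyTestFunction eos ρ u ϑ) =
      fun z => ‖stLift u z‖ ^ 2 / 2 - (uncurry eos.chemPotential ∘ fun z => (stLift ρ z, stLift ϑ z)) z := by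
    funext z; rfl
  rw [heq]
  exact ((hu.norm_sq ℝ).div_const 2).sub hμ

/-- The slices of `φ₁` are `C¹` torus functions. [folklore] -/
theorem isContDiff_energyTestFunction (h : IsClassicalEulerSolution eos T₁ ρ u ϑ)
    (hG : eos.IsGibbs) {t : ℝ} (ht : t ∈ Ico 0 T₁) :
    IsContDiff 1 (energyTestFunction eos ρ u ϑ t) := by
  obtain ⟨hρ1, hϑ1, hu1, -⟩ := h.isContDiff_slices ht
  have hpos : ∀ y, (ρ t y, ϑ t y) ∈ Ioi (0 : ℝ) ×ˢ Ioi (0 : ℝ) := fun y =>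
    ⟨h.density_pos t ht y, h.temperature_pos t ht y⟩
  have hμ : IsContDiff 1 (fun y => eos.chemPotential (ρ t y) (ϑ t y)) :=
    isContDiff_comp₂ (IsGibbs.contDiffOn_uncurry_chemPotential hG) le_rfl hρ1 hϑ1 hpos
  have hkin : IsContDiff 1 (fun y => ‖u t y‖ ^ 2 / 2) := by
    have : (fun y => ‖u t y‖ ^ 2 / 2) = fun y => (1 / 2 : ℝ) • ‖u t y‖ ^ 2 := by
      funext y; simp [div_eq_inv_mul]
    rw [this]; exact (hu1.norm_sq ℝ).const_smul _
  exact ContDiff.sub hkin hμ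

/-- **Time derivative of `φ₁`**: `∂ₜφ₁ = U·∂ₜU - (μ_ρ ∂ₜr + μ_Θ ∂ₜΘ)` with `μ_ρ = p_ρ/r`,
`μ_Θ = -s + p_ϑ/r` (Gibbs–Duhem), i.e. `StrongPointData.φ₁t`. [cite: BrezinaFeireisl2018, (3.4)–(3.5)] -/
theorem timeDerivWithin_energyTestFunction (h : IsClassicalEulerSolution eos T₁ ρ u ϑ)
    (hG : eos.IsGibbs) {t : ℝ} (ht : t ∈ Ico 0 T₁) (x : UnitAddTorus (Fin 3)) :
    timeDerivWithin (Ico 0 T₁) (energyTestFunction eos ρ u ϑ) t x =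
      (classicalPointData (Ico 0 T₁) ρ u ϑ t x).φ₁t eos := by
  have hS := uniqueDiffOn_Ico_time T₁
  have hr : 0 < ρ t x := h.density_pos t ht x
  have hΘ : 0 < ϑ t x := h.temperature_pos t ht x
  have hd_ρ := h.smooth_density.hasDerivWithinAt_slice ht x
  have hd_u := h.smooth_velocity.hasDerivWithinAt_slice ht x
  have hd_ϑ := h.smooth_temperature.hasDerivWithinAt_slice ht x
  have hd_kin : HasDerivWithinAt (fun τ => ‖u τ x‖ ^ 2 / 2)
      (∑ k, u t x k * timeDerivWithin (Ico 0 T₁) u t x k) (Ico 0 T₁) t := by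
    have h1 := (hd_u.inner ℝ hd_u).div_const 2
    have heq : (fun τ => ⟪u τ x, u τ x⟫_ℝ / 2) = fun τ => ‖u τ x‖ ^ 2 / 2 := by
      funext τ; rw [real_inner_self_eq_norm_sq]
    rw [heq] at h1
    refine h1.congr_deriv ?_
    rw [real_inner_comm, ← two_mul, mul_div_cancel_left₀ _ two_ne_zero, PiLp.inner_apply]
    exact Finset.sum_congr rfl fun k _ => by simp
  have hd_μ := hasDerivWithinAt_comp₂ (IsGibbs.contDiffOn_uncurry_chemPotential hG)
    isOpen_quadrant le_rfl (a := fun τ => ρ τ x) (b := fun τ => ϑ τ x) ⟨hr, hΘ⟩ hd_ρ hd_ϑ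
  have key := (hd_kin.sub hd_μ).derivWithin (hS t ht)
  rw [(hG.hasDerivAt_chemPotential_rho hr hΘ).deriv,
    (hG.hasDerivAt_chemPotential_theta hr hΘ).deriv] at key
  unfold energyTestFunction
  simp only [φ₁t, μρ, μϑ, pρ, pϑ, classicalPointData]
  exact key

/-- **Gradient of `φ₁`**: `∂ⱼφ₁ = ∑ᵢ Uᵢ ∂ⱼUᵢ - (μ_ρ ∂ⱼr + μ_Θ ∂ⱼΘ)`, i.e.
`StrongPointData.gφ₁`. [cite: BrezinaFeireisl2018, (3.4)–(3.5)] -/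
theorem gradient_energyTestFunction (h : IsClassicalEulerSolution eos T₁ ρ u ϑ)
    (hG : eos.IsGibbs) {t : ℝ} (ht : t ∈ Ico 0 T₁) (x : UnitAddTorus (Fin 3)) (j : Fin 3) :
    Torus.gradient (energyTestFunction eos ρ u ϑ t) x j =
      (classicalPointData (Ico 0 T₁) ρ u ϑ t x).gφ₁ eos j := by
  obtain ⟨hρ1, hϑ1, hu1, -⟩ := h.isContDiff_slices ht
  have hpos : ∀ y, (ρ t y, ϑ t y) ∈ Ioi (0 : ℝ) ×ˢ Ioi (0 : ℝ) := fun y =>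
    ⟨h.density_pos t ht y, h.temperature_pos t ht y⟩
  have hr : 0 < ρ t x := h.density_pos t ht x
  have hΘ : 0 < ϑ t x := h.temperature_pos t ht x
  have hμ : IsContDiff 1 (fun y => eos.chemPotential (ρ t y) (ϑ t y)) :=
    isContDiff_comp₂ (IsGibbs.contDiffOn_uncurry_chemPotential hG) le_rfl hρ1 hϑ1 hpos
  have hkin : IsContDiff 1 (fun y => ‖u t y‖ ^ 2 / 2) := by
    have : (fun y => ‖u t y‖ ^ 2 / 2) = fun y => (1 / 2 : ℝ) • ‖u t y‖ ^ 2 := by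
      funext y; simp [div_eq_inv_mul]
    rw [this]; exact (hu1.norm_sq ℝ).const_smul _
  rw [gradient_apply (h.isContDiff_energyTestFunction hG ht)]
  have hsub : partialDeriv j (energyTestFunction eos ρ u ϑ t) x =
      partialDeriv j (fun y => ‖u t y‖ ^ 2 / 2) x -
        partialDeriv j (fun y => eos.chemPotential (ρ t y) (ϑ t y)) x :=
    partialDeriv_sub_apply hkin hμ j x
  rw [hsub, partialDeriv_half_norm_sq hu1]
  have hμ' := partialDeriv_comp₂ (IsGibbs.contDiffOn_uncurry_chemPotential hG) isOpen_quadrant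
    le_rfl hρ1 hϑ1 x (hpos x) j
  rw [(hG.hasDerivAt_chemPotential_rho hr hΘ).deriv,
    (hG.hasDerivAt_chemPotential_theta hr hΘ).deriv] at hμ'
  rw [hμ']
  simp only [gφ₁, μρ, μϑ, pρ, pϑ, classicalPointData, gradient_apply hρ1, gradient_apply hϑ1]

/-- **The pressure flux**: `div(p(ρ,ϑ) u) = p divU + U·∇p` pointwise, in terms of the point
data, and `∫_{𝕋³} div(p(ρ,ϑ) u) dx = 0`. [cite: BrezinaFeireisl2018, (3.9)–(3.10)] -/
theorem div_pressure_flux (h : IsClassicalEulerSolution eos T₁ ρ u ϑ) (hG : eos.IsGibbs)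
    {t : ℝ} (ht : t ∈ Ico 0 T₁) :
    (∀ x, Torus.divergence (fun y => eos.p (ρ t y) (ϑ t y) • u t y) x =
      eos.p (ρ t x) (ϑ t x) * (classicalPointData (Ico 0 T₁) ρ u ϑ t x).divU +
        ∑ j, (classicalPointData (Ico 0 T₁) ρ u ϑ t x).U j *
          (classicalPointData (Ico 0 T₁) ρ u ϑ t x).gp eos j) ∧
    ∫ x, Torus.divergence (fun y => eos.p (ρ t y) (ϑ t y) • u t y) x = 0 := by
  obtain ⟨hρ1, hϑ1, hu1, hui⟩ := h.isContDiff_slices ht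
  have hpos : ∀ y, (ρ t y, ϑ t y) ∈ Ioi (0 : ℝ) ×ˢ Ioi (0 : ℝ) := fun y =>
    ⟨h.density_pos t ht y, h.temperature_pos t ht y⟩
  have hpc : IsContDiff 1 (fun y => eos.p (ρ t y) (ϑ t y)) := isContDiff_comp₂ hG.1 le_rfl hρ1 hϑ1 hpos
  refine ⟨fun x => ?_, integral_divergence_eq_zero_of_isContDiff (ContDiff.smul hpc hu1)⟩
  rw [divergence_smul hpc hu1]
  simp only [divU, gp, pρ, pϑ, classicalPointData, gradient_apply hρ1, gradient_apply hϑ1,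
    partialDeriv_comp₂ hG.1 isOpen_quadrant le_rfl hρ1 hϑ1 x (hpos x)]
  unfold Torus.divergence
  simp only [partialDeriv_apply_coord hu1]

/-! ## Uniform bounds and the compact range on `[0,T]` -/

/-- **Uniform bound on the point data**: for `T < T₁` there is `M ≥ 0` with
`(classicalPointData … t x).Bounded M` for all `(t,x) ∈ [0,T] × 𝕋³`. [folklore] -/
theorem exists_bound_pointData (h : IsClassicalEulerSolution eos T₁ ρ u ϑ) {T : ℝ}
    (hT : T < T₁) :
    ∃ M : ℝ, 0 ≤ M ∧ ∀ t ∈ Icc 0 T, ∀ x, (classicalPointData (Ico 0 T₁) ρ u ϑ t x).Bounded M := by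
  have hS := uniqueDiffOn_Ico_time T₁
  have hK : IsCompact (Icc (0 : ℝ) T) := isCompact_Icc
  have hKS : Icc (0 : ℝ) T ⊆ Ico 0 T₁ := fun t ht => ⟨ht.1, lt_of_le_of_lt ht.2 hT⟩
  obtain ⟨C₁, hC₁⟩ := (h.smooth_density.timeDerivWithin hS).exists_norm_le_of_isCompact hK hKS
  obtain ⟨C₂, hC₂⟩ := (h.smooth_temperature.timeDerivWithin hS).exists_norm_le_of_isCompact hK hKS
  obtain ⟨C₃, hC₃⟩ := h.smooth_velocity.exists_norm_le_of_isCompact hK hKS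
  obtain ⟨C₄, hC₄⟩ := (h.smooth_velocity.timeDerivWithin hS).exists_norm_le_of_isCompact hK hKS
  obtain ⟨C₅, hC₅⟩ := (h.smooth_density.gradient hS).exists_norm_le_of_isCompact hK hKS
  obtain ⟨C₆, hC₆⟩ := (h.smooth_temperature.gradient hS).exists_norm_le_of_isCompact hK hKS
  obtain ⟨C₇, hC₇⟩ : ∃ C, ∀ j, ∀ t ∈ Icc (0 : ℝ) T, ∀ x, ‖partialDeriv j (u t) x‖ ≤ C := by
    have hb : ∀ j, ∃ C, ∀ t ∈ Icc (0 : ℝ) T, ∀ x, ‖partialDeriv j (u t) x‖ ≤ C := fun j =>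
      (h.smooth_velocity.partialDeriv hS j).exists_norm_le_of_isCompact hK hKS
    choose C hC using hb
    exact ⟨∑ j, |C j|, fun j t ht x => (hC j t ht x).trans
      ((le_abs_self _).trans (Finset.single_le_sum (f := fun j => |C j|)
        (fun j _ => abs_nonneg _) (Finset.mem_univ j)))⟩
  have a1 := abs_nonneg C₁; have a2 := abs_nonneg C₂; have a3 := abs_nonneg C₃
  have a4 := abs_nonneg C₄; have a5 := abs_nonneg C₅; have a6 := abs_nonneg C₆
  have a7 := abs_nonneg C₇
  obtain ⟨M, hM0, h1, h2, h3, h4, h5, h6, h7⟩ : ∃ M : ℝ, 0 ≤ M ∧ |C₁| ≤ M ∧ |C₂| ≤ M ∧ |C₃| ≤ M ∧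
      |C₄| ≤ M ∧ |C₅| ≤ M ∧ |C₆| ≤ M ∧ |C₇| ≤ M :=
    ⟨|C₁| + |C₂| + |C₃| + |C₄| + |C₅| + |C₆| + |C₇|, by positivity, by linarith, by linarith,
      by linarith, by linarith, by linarith, by linarith, by linarith⟩
  refine ⟨M, hM0, fun t ht x => ?_⟩
  obtain ⟨hρ1, hϑ1, hu1, -⟩ := h.isContDiff_slices (hKS ht)
  have habs : ∀ {a C : ℝ}, ‖a‖ ≤ C → |C| ≤ M → |a| ≤ M := fun ha hC =>
    (Real.norm_eq_abs _ ▸ ha).trans ((le_abs_self _).trans hC)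
  have hcoord : ∀ {v : EuclideanSpace ℝ (Fin 3)} {C : ℝ} (i : Fin 3), ‖v‖ ≤ C → |C| ≤ M →
      |v i| ≤ M := by
    intro v C i hv hC
    exact (Real.norm_eq_abs _ ▸ PiLp.norm_apply_le v i).trans (hv.trans ((le_abs_self _).trans hC))
  refine ⟨habs (hC₁ t ht x) h1, habs (hC₂ t ht x) h2, fun i => hcoord i (hC₃ t ht x) h3,
    fun i => hcoord i (hC₄ t ht x) h4, fun i => hcoord i (hC₅ t ht x) h5,
    fun i => hcoord i (hC₆ t ht x) h6, fun i j => ?_⟩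
  simp only [classicalPointData]
  rw [partialDeriv_apply_coord hu1 j x i]
  exact hcoord i (hC₇ j t ht x) h7

/-- **Compact range of `(ρ,ϑ)` on `[0,T] × 𝕋³`** inside the open quadrant. [folklore] -/
theorem isCompact_range_thermo (h : IsClassicalEulerSolution eos T₁ ρ u ϑ) {T : ℝ} (hT : T < T₁) :
    IsCompact ((fun z : ℝ × UnitAddTorus (Fin 3) => (ρ z.1 z.2, ϑ z.1 z.2)) '' (Icc 0 T ×ˢ univ)) ∧
    (fun z : ℝ × UnitAddTorus (Fin 3) => (ρ z.1 z.2, ϑ z.1 z.2)) '' (Icc 0 T ×ˢ univ) ⊆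
      Ioi 0 ×ˢ Ioi 0 := by
  have hKS : Icc (0 : ℝ) T ⊆ Ico 0 T₁ := fun t ht => ⟨ht.1, lt_of_le_of_lt ht.2 hT⟩
  constructor
  · -- continuity of `(t, x) ↦ (ρ t x, ϑ t x)` on `[0,T] × 𝕋³` through the lift
    have hc : ContinuousOn (fun z : ℝ × EuclideanSpace ℝ (Fin 3) => (stLift ρ z, stLift ϑ z))
        (Icc 0 T ×ˢ univ) :=
      (h.smooth_density.continuousOn_stLift.mono (prod_mono hKS subset_rfl)).prodMk
        (h.smooth_temperature.continuousOn_stLift.mono (prod_mono hKS subset_rfl))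
    have himage : (fun z : ℝ × UnitAddTorus (Fin 3) => (ρ z.1 z.2, ϑ z.1 z.2)) '' (Icc 0 T ×ˢ univ) =
        (fun z : ℝ × EuclideanSpace ℝ (Fin 3) => (stLift ρ z, stLift ϑ z)) ''
          (Icc 0 T ×ˢ ((WithLp.toLp 2) '' (Set.pi univ fun _ : Fin 3 => Icc (0 : ℝ) 1))) := by
      ext q
      constructor
      · rintro ⟨⟨t, x⟩, ⟨ht, -⟩, rfl⟩
        exact ⟨(t, repr x), ⟨ht, repr_mem_toLp_image_pi_Icc x⟩, by simp [stLift]⟩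
      · rintro ⟨⟨t, y⟩, ⟨ht, -⟩, rfl⟩
        exact ⟨(t, proj y), ⟨ht, mem_univ _⟩, rfl⟩
    rw [himage]
    exact (isCompact_Icc.prod isCompact_toLp_image_pi_Icc).image_of_continuousOn
      (hc.mono (prod_mono subset_rfl (subset_univ _)))
  · rintro q ⟨⟨t, x⟩, ⟨ht, -⟩, rfl⟩
    exact ⟨h.density_pos t (hKS ht) x, h.temperature_pos t (hKS ht) x⟩

end IsClassicalEulerSolution

end CompressibleEuler

end Literature.Analysis.FluidPDE
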